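import Summits.CriticalPhenomena.PercolationContinuityZ3.Theorems.PercNearOneGluingAdditiveGluingMultiEdgeLemma3
import HarnessLib

/-! # Crux `PercNearOneGluing.AdditiveGluing` (stmt-CriticalPhenomena-4576) — the T-form PEEL identity (strategy (b))

Support file (`--supports stmt-CriticalPhenomena-4576`); no definitions, no named facts.  Companion of
`…AdditiveGluingMultiEdgeLemma3.lean` (ML3) and `…AdditiveGluingTStarExpansion.lean` (star expansion).

`μ_w = prodBernoulli w` on `Fin n`; `T_d^w(β) := μ_w(β ↮ A) + μ_w(β ↔ b) − μ_w(d ↔ b)` (the crux `AdditiveGluing` at `β` is `T_{a*}(β) ≥ 0`).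
For `T ⊆ A` (the relay neighbours of `β` to be peeled), `F = {s(β,a) : a ∈ T}`, `R = {some edge of F open}` and `w⁰ = pinW w F ∅`
(those edges deleted):

  **`T_d^w(β) = [μ_w(R ∩ {β ↔ b}) − μ_w(R ∩ {d ↔ b})] + μ_w([∅]_F) · T_d^{w⁰}(β)`**      (`theorem T_peel`)

— the first bracket is the multi-edge Lemma 3 term (`≥ 0` by `multiEdge_lemma3` when `τ(d) ≤ τ(a)` on `T`, `≥ −δ` by
`multiEdge_lemma3_delta`), the second is `P(no edge of F open)` times the T-functional in the weighting with the star `F` removed, to which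
`T_starExpansion` applies.  Ingredients: `{β ↮ A} ⊆ Rᶜ` (an open edge `β–a`, `a ∈ T ⊆ A`, joins `β` to `A`), and the pattern decomposition
`μ_w(Rᶜ ∩ E) = μ_w([∅]_F) · μ_{w⁰}(E)` (`prodBernoulli_real_inter_eq_sum_pinW`, only the empty pattern misses `R`).
[cite: KozmaNitzan2024, §3.2 pp. 12–14; Grimmett1999, §2.2]
-/

namespace Summit.CriticalPhenomena.PercolationContinuityZ3.Theorems

open MeasureTheory Set
open Literature.Probability.LatticeModels (prodBernoulli)
open Literature.Probability.Percolation (BondConfig openConn openGraph pinW localCylinder DeterminedBy determinedBy_iff)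

noncomputable section
open Classical

section TPeel

open Literature.Probability.LatticeModels Literature.Probability.Percolation

variable {n : ℕ}

/-- **Only the empty pattern misses `R`**: for `R` = "some edge of `F` open" and any event `E`,
`μ_w(Rᶜ ∩ E) = μ_w([∅]_F) · μ_{pinW w F ∅}(E)`. [folklore; Grimmett 1999 §2.2] -/
theorem real_noneOpen_inter (w : Sym2 (Fin n) → unitInterval) (F : Finset (Sym2 (Fin n))) (E : Set (BondConfig (Fin n))) :
    (prodBernoulli w).real ({ω : Set (Sym2 (Fin n)) | ∃ e ∈ F, e ∈ ω}ᶜ ∩ E) =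
      (prodBernoulli w).real (localCylinder ↑F ↑(∅ : Finset (Sym2 (Fin n)))) *
        (prodBernoulli (pinW w ↑F ↑(∅ : Finset (Sym2 (Fin n))))).real E := by
  rw [Set.inter_comm,
    prodBernoulli_real_inter_eq_sum_pinW w F (A := E) (B := {ω : Set (Sym2 (Fin n)) | ∃ e ∈ F, e ∈ ω}ᶜ)
      MeasurableSet.of_discrete (determinedBy_forall_not_mem F)]
  refine Finset.sum_eq_single_of_mem ∅ ?_ ?_
  · refine (@Finset.mem_filter _ _ (_) _ _).2 ⟨Finset.mem_powerset.2 (Finset.empty_subset F), ?_⟩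
    rintro ⟨e, -, he⟩
    exact Finset.notMem_empty e (Finset.mem_coe.1 he)
  · intro J hJ hne
    exfalso
    obtain ⟨hJF, hno⟩ := (@Finset.mem_filter _ _ (_) _ _).1 hJ
    obtain ⟨e, heJ⟩ := Finset.nonempty_iff_ne_empty.2 hne
    exact hno ⟨e, Finset.mem_powerset.1 hJF heJ, Finset.mem_coe.2 heJ⟩

/-- Split of any event along `R`: `μ(E) = μ(R ∩ E) + μ([∅]_F)·μ_{w⁰}(E)`. [folklore] -/
theorem real_eq_someOpen_add_noneOpen (w : Sym2 (Fin n) → unitInterval) (F : Finset (Sym2 (Fin n)))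
    (E : Set (BondConfig (Fin n))) :
    (prodBernoulli w).real E =
      (prodBernoulli w).real ({ω : Set (Sym2 (Fin n)) | ∃ e ∈ F, e ∈ ω} ∩ E) +
        (prodBernoulli w).real (localCylinder ↑F ↑(∅ : Finset (Sym2 (Fin n)))) *
          (prodBernoulli (pinW w ↑F ↑(∅ : Finset (Sym2 (Fin n))))).real E := by
  rw [← real_noneOpen_inter w F E]
  have h := measureReal_inter_add_sdiff (μ := prodBernoulli w) (s := E)
    (t := {ω : Set (Sym2 (Fin n)) | ∃ e ∈ F, e ∈ ω}) MeasurableSet.of_discrete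
  rw [Set.inter_comm] at h
  rw [← h, Set.sdiff_eq_compl_inter]

/-- **The T-form peel identity.**  For `β ∉ A`... only `T ⊆ A` is needed: with `R` = some edge `β–T` open and `w⁰` the weighting with
those edges deleted, `μ_w(β ↮ A) + μ_w(β ↔ b) − μ_w(d ↔ b) = [μ_w(R ∩ {β↔b}) − μ_w(R ∩ {d↔b})] + μ_w([∅]) · (μ_{w⁰}(β ↮ A) + μ_{w⁰}(β ↔ b) − μ_{w⁰}(d ↔ b))`.
[cite: KozmaNitzan2024, §3.2 pp. 12–14] -/
theorem T_peel (w : Sym2 (Fin n) → unitInterval) (A T : Finset (Fin n)) (β d b : Fin n) (hTA : T ⊆ A) :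
    (prodBernoulli w).real {ω : BondConfig (Fin n) | ∀ a ∈ A, ¬ (openGraph ω).Reachable β a} +
        (prodBernoulli w).real (openConn β b) - (prodBernoulli w).real (openConn d b) =
      ((prodBernoulli w).real ({ω : Set (Sym2 (Fin n)) | ∃ a ∈ T, s(β, a) ∈ ω} ∩ openConn β b) -
          (prodBernoulli w).real ({ω : Set (Sym2 (Fin n)) | ∃ a ∈ T, s(β, a) ∈ ω} ∩ openConn d b)) +
        (prodBernoulli w).real (localCylinder ↑(T.image fun a => s(β, a)) ↑(∅ : Finset (Sym2 (Fin n)))) *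
          ((prodBernoulli (pinW w ↑(T.image fun a => s(β, a)) ↑(∅ : Finset (Sym2 (Fin n))))).real
              {ω : BondConfig (Fin n) | ∀ a ∈ A, ¬ (openGraph ω).Reachable β a} +
            (prodBernoulli (pinW w ↑(T.image fun a => s(β, a)) ↑(∅ : Finset (Sym2 (Fin n))))).real (openConn β b) -
            (prodBernoulli (pinW w ↑(T.image fun a => s(β, a)) ↑(∅ : Finset (Sym2 (Fin n))))).real (openConn d b)) := by
  set F : Finset (Sym2 (Fin n)) := T.image (fun a => s(β, a)) with hFdef
  have hR : {ω : Set (Sym2 (Fin n)) | ∃ a ∈ T, s(β, a) ∈ ω} = {ω | ∃ e ∈ F, e ∈ ω} := by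
    ext ω
    simp only [Set.mem_setOf_eq, hFdef, Finset.mem_image]
    constructor
    · rintro ⟨a, haT, ha⟩; exact ⟨s(β, a), ⟨a, haT, rfl⟩, ha⟩
    · rintro ⟨e, ⟨a, haT, rfl⟩, he⟩; exact ⟨a, haT, he⟩
  rw [hR]
  set R : Set (Set (Sym2 (Fin n))) := {ω | ∃ e ∈ F, e ∈ ω} with hRdef
  -- `{β ↮ A} ∩ R = ∅`: an open edge `β–a`, `a ∈ T ⊆ A`, joins `β` to `A`
  have hdead : R ∩ {ω : BondConfig (Fin n) | ∀ a ∈ A, ¬ (openGraph ω).Reachable β a} = ∅ := by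
    ext ω
    simp only [Set.mem_inter_iff, Set.mem_setOf_eq, Set.mem_empty_iff_false, iff_false, not_and, hRdef]
    rintro ⟨e, heF, heω⟩ h
    obtain ⟨a, haT, rfl⟩ := Finset.mem_image.1 heF
    by_cases haβ : a = β
    · -- a loop at `β` cannot occur as `β ∉ A ⊇ T`? we do not assume it; but then `β ∈ A` and `β ↔ β`
      exact h a (hTA haT) (haβ ▸ SimpleGraph.Reachable.refl _)
    · exact h a (hTA haT) (SimpleGraph.Adj.reachable ((openGraph_adj ω β a).2 ⟨heω, fun h' => haβ h'.symm⟩))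
  have h1 := real_eq_someOpen_add_noneOpen w F {ω : BondConfig (Fin n) | ∀ a ∈ A, ¬ (openGraph ω).Reachable β a}
  have h2 := real_eq_someOpen_add_noneOpen w F (openConn β b)
  have h3 := real_eq_someOpen_add_noneOpen w F (openConn d b)
  rw [hdead, measureReal_empty, zero_add] at h1
  rw [h1, h2, h3]
  ring

/-- Registered rung `stub_Tpeel_b` of crux stmt-CriticalPhenomena-4576 (seat b): the T-form peel identity — `T_peel`, closed statement.
[cite: KozmaNitzan2024, §3.2 pp. 12–14] -/
theorem stub_Tpeel_b : ∀ (n : ℕ) (w : Sym2 (Fin n) → unitInterval) (A T : Finset (Fin n)) (β d b : Fin n), T ⊆ A → (Literature.Probability.LatticeModels.prodBernoulli w).real {ω : Literature.Probability.Percolation.BondConfig (Fin n) | ∀ a ∈ A, ¬ (Literature.Probability.Percolation.openGraph ω).Reachable β a} + (Literature.Probability.LatticeModels.prodBernoulli w).real (Literature.Probability.Percolation.openConn β b) - (Literature.Probability.LatticeModels.prodBernoulli w).real (Literature.Probability.Percolation.openConn d b) = ((Literature.Probability.LatticeModels.prodBernoulli w).real ({ω : Set (Sym2 (Fin n)) |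 ∃ a ∈ T, s(β, a) ∈ ω} ∩ Literature.Probability.Percolation.openConn β b) - (Literature.Probability.LatticeModels.prodBernoulli w).real ({ω : Set (Sym2 (Fin n)) | ∃ a ∈ T, s(β, a) ∈ ω} ∩ Literature.Probability.Percolation.openConn d b)) + (Literature.Probability.LatticeModels.prodBernoulli w).real (Literature.Probability.Percolation.localCylinder (↑(T.image fun a => s(β, a)) : Set (Sym2 (Fin n))) ↑(∅ : Finset (Sym2 (Fin n)))) * ((Literature.Probability.LatticeModels.prodBernoulli (Literature.Probability.Percolation.pinW w (↑(T.image fun a => s(β, a)) : Set (Sym2 (Fin n))) ↑(∅ : Finset (Sym2 (Fin n))))).real {ω : Literature.Probability.Percolation.BondConfig (Fin n) | ∀ a ∈ A, ¬ (Literature.Probability.Percolation.openGraph ω).Reachable β a} + (Literature.Probability.LatticeModels.prodBernoulli (Literature.Probability.Percolation.pinW w (↑(T.image fun a => s(β, a)) : Set (Sym2 (Fin n))) ↑(∅ : Finset (Sym2 (Fin n))))).real (Literature.Probability.Percolation.openConn β b) - (Literature.Probability.LatticeModels.prodBernoulli (Literature.Probability.Percolation.pinW w (↑(T.image fun a =>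 s(β, a)) : Set (Sym2 (Fin n))) ↑(∅ : Finset (Sym2 (Fin n))))).real (Literature.Probability.Percolation.openConn d b)) :=
  fun _ w A T β d b hTA => T_peel w A T β d b hTA

end TPeel

end

end Summit.CriticalPhenomena.PercolationContinuityZ3.Theorems
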